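import Literature.NumberTheory.EllipticCurves.Gamma0EisensteinWeightOneQExpansion
import Literature.NumberTheory.EllipticCurves.EisensteinWeightOneCusps
import Mathlib.Analysis.Complex.LocallyUniformLimit
import Mathlib.NumberTheory.ModularForms.Basic
import Mathlib.NumberTheory.ModularForms.CongruenceSubgroups
import Mathlib.NumberTheory.ModularForms.QExpansion
import HarnessLib

/-!
# Hecke's holomorphic weight-one Eisenstein series `G̃_χ(z, 0)` as a modular form on `Γ₁(M)`

Topic `Literature/NumberTheory/EllipticCurves`; namespace
`Literature.NumberTheory.EllipticCurves.ModularForms`.  Definitions with bodies (`heckeOne`,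
`congrConst`, `heckeOneCusp`, `heckeOneMF`) and theorems; no named fact.

For an odd primitive Dirichlet character `χ` modulo `M ≥ 1`, Hecke's continued weight-one
Eisenstein series `G̃_χ(z, s) = ∑_{(c,d), M ∣ c} χ(d)(cz+d)⁻¹(y/|cz+d|²)ˢ`
(`Gamma0EisensteinWeightOneContinuation`) at `s = 0` is a holomorphic modular form of weight `1`
on `Γ₁(M)` with nebentypus `χ̄` (Hecke 1927, §2; Miyake Thm. 7.2.13):

* `heckeOne_slash_of_mem_gamma0` — `G̃(·,0) ∣₁ γ = χ̄(d) G̃(·,0)` for `γ ∈ Γ₀(M)` (from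
  `eisensteinOneCont_smul` at `s = 0`);
* `heckeOne_slash_apply` — for EVERY `A ∈ SL₂(ℤ)`,
  `(G̃(·,0) ∣₁ A)(z) = ∑_{v₀ mod M} W_A(v₀) congrCont(z, 0; v₀)` (`eq_sum_congrCont_of_eqOn`);
* `tendsto_congrCont_zero_atImInfty` — `congrCont(z, 0; v₀) → congrConst v₀ =
  M⁻¹ (𝟙[M ∣ c₀] 2ζ_odd(d₀/M, 1) - 2πi ζ_odd(c₀/M, 0))` as `Im z → ∞` (the column series is
  `O(y⁻²)` by `norm_congrColumn_le`, `constIntegral_zero`);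
* `tendsto_heckeOne_slash_atImInfty` — hence the limits `heckeOneCusp χ A` at all cusps;
* `mdifferentiable_heckeOne` — holomorphy on `ℍ`, from the `q`-expansion
  `G̃(z,0) = 2L(χ,1) - (4πiτ(χ)/M) ∑ σ^{χ̄}(m) qᵐ` (`eisensteinOneCont_zero_qExpansion`) and the
  general `differentiableOn_qSeries`;
* `heckeOneMF` — the modular form, and `qExpansion_coeff_heckeOneMF` — its `q`-expansion.

## References

* E. Hecke, *Theorie der Eisensteinschen Reihen höherer Stufe und ihre Anwendung auf
  Funktionentheorie und Arithmetik*, Abh. Math. Sem. Hamburg 5 (1927), §2. [Hecke1927]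
* T. Miyake, *Modular Forms*, Springer (2006), §7.2 (Thm. 7.2.13). [Miyake2006]
* F. Diamond, J. Shurman, *A First Course in Modular Forms*, GTM 228 (2005), §4.8.
  [DiamondShurman2005]
-/

noncomputable section

open Complex UpperHalfPlane Filter Finset CongruenceSubgroup ModularForm Matrix HurwitzZeta
open scoped Real Topology MatrixGroups Manifold

namespace Literature.NumberTheory.EllipticCurves.ModularForms

/-! ### Holomorphy of `q`-series with polynomially bounded coefficients -/

/-- A `q`-series `∑ aₙ e^{2πinw}` with `‖aₙ‖ ≤ C (n+1)^k` is holomorphic on `Im w > 0`. [folklore] -/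
theorem differentiableOn_qSeries {a : ℕ → ℂ} {C : ℝ} {k : ℕ} (ha : ∀ n, ‖a n‖ ≤ C * ((n : ℝ) + 1) ^ k) :
    DifferentiableOn ℂ (fun w : ℂ ↦ ∑' n : ℕ, a n * cexp (2 * π * Complex.I * w) ^ n) {w : ℂ | 0 < w.im} := by
  intro w₀ hw₀
  simp only [Set.mem_setOf_eq] at hw₀
  set δ : ℝ := w₀.im / 2 with hδ
  have hδ0 : 0 < δ := by positivity
  set U : Set ℂ := {w : ℂ | δ < w.im} with hU
  have hUo : IsOpen U := isOpen_lt continuous_const Complex.continuous_im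
  have hw₀U : w₀ ∈ U := by simp only [hU, Set.mem_setOf_eq, hδ]; linarith
  set r : ℝ := Real.exp (-2 * π * δ) with hr
  have hr0 : 0 ≤ r := (Real.exp_pos _).le
  have hr1 : r < 1 := Real.exp_lt_one_iff.mpr (by nlinarith [Real.pi_pos])
  have hC : 0 ≤ C := by
    have := (norm_nonneg (a 0)).trans (ha 0)
    simpa using this
  -- the summable majorant `C (n+1)^k r^n`
  have hsum : Summable fun n : ℕ ↦ C * ((n : ℝ) + 1) ^ k * r ^ n := by
    have h1 : Summable fun n : ℕ ↦ ((n : ℝ)) ^ k * r ^ n :=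
      summable_pow_mul_geometric_of_norm_lt_one k (by rwa [Real.norm_of_nonneg hr0])
    have h2 := (summable_nat_add_iff 1).mpr h1
    have hrpos : 0 < r := Real.exp_pos _
    refine ((h2.mul_left (C * r⁻¹))).congr fun n ↦ ?_
    simp only [Nat.cast_add, Nat.cast_one, pow_succ]
    field_simp
  have hterm : ∀ n : ℕ, DifferentiableOn ℂ (fun w : ℂ ↦ a n * cexp (2 * π * Complex.I * w) ^ n) U :=
    fun n ↦ ((differentiable_const _).mul
      (((differentiable_const _).mul differentiable_id).cexp.pow n)).differentiableOn
  have hle : ∀ (n : ℕ) (w : ℂ), w ∈ U → ‖a n * cexp (2 * π * Complex.I * w) ^ n‖ ≤ C * ((n : ℝ) + 1) ^ k * r ^ n := by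
    intro n w hw
    simp only [hU, Set.mem_setOf_eq] at hw
    rw [norm_mul, norm_pow]
    refine mul_le_mul (ha n) (pow_le_pow_left₀ (norm_nonneg _) ?_ n) (by positivity) (by positivity)
    rw [Complex.norm_exp]
    refine Real.exp_le_exp.mpr ?_
    have : (2 * π * Complex.I * w).re = -2 * π * w.im := by
      simp [Complex.mul_re, Complex.mul_im]
    rw [this]
    nlinarith [Real.pi_pos]
  have hdiff := differentiableOn_tsum_of_summable_norm hsum hterm hUo hle
  exact (hdiff.differentiableAt (hUo.mem_nhds hw₀U)).differentiableWithinAt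

/-- A function on `ℍ` given by such a `q`-series is holomorphic. [folklore] -/
theorem mdifferentiable_of_eq_qSeries {f : ℍ → ℂ} {a : ℕ → ℂ} {C : ℝ} {k : ℕ}
    (ha : ∀ n, ‖a n‖ ≤ C * ((n : ℝ) + 1) ^ k)
    (hf : ∀ z : ℍ, f z = ∑' n : ℕ, a n * cexp (2 * π * Complex.I * z) ^ n) :
    MDifferentiable 𝓘(ℂ) 𝓘(ℂ) f := by
  rw [UpperHalfPlane.mdifferentiable_iff]
  refine (differentiableOn_qSeries ha).congr fun w hw ↦ ?_
  simp only [Set.mem_setOf_eq] at hw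
  rw [Function.comp_apply, hf, ofComplex_apply_of_im_pos hw]

/-! ### Hecke's series at `s = 0` -/

section Hecke

variable {M : ℕ} [NeZero M] (χ : DirichletCharacter ℂ M)

/-- **Hecke's holomorphic weight-one Eisenstein series** `z ↦ G̃_χ(z, 0)`.
[cite: Hecke1927, §2] [cite: Miyake2006, Thm. 7.2.13] -/
def heckeOne : ℍ → ℂ := fun z ↦ eisensteinOneCont χ z 0

/-- **Nebentypus `χ̄` on `Γ₀(M)`**: `G̃(·,0) ∣₁ γ = χ̄(d_γ) · G̃(·,0)` (odd `χ`).
[cite: Hecke1927, §2] [cite: Miyake2006, Thm. 7.2.13] -/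
theorem heckeOne_slash_of_mem_gamma0 (hodd : χ.Odd) {γ : SL(2, ℤ)} (hγ : γ ∈ Gamma0 M) :
    heckeOne χ ∣[(1 : ℤ)] γ = χ⁻¹ ((γ 1 1 : ℤ) : ZMod M) • heckeOne χ := by
  funext z
  have h := eisensteinOneCont_smul χ hodd hγ z (s := 0) (by norm_num)
  have hdet := Matrix.SpecialLinearGroup.det_coe γ
  rw [Matrix.det_fin_two] at hdet
  have hc : ((γ 1 0 : ℤ) : ZMod M) = 0 := Gamma0_mem.mp hγ
  have had : ((γ 0 0 : ℤ) : ZMod M) * ((γ 1 1 : ℤ) : ZMod M) = 1 := by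
    have := congrArg (fun x : ℤ ↦ (x : ZMod M)) hdet
    simp only [Int.cast_sub, Int.cast_mul, Int.cast_one, hc, mul_zero, sub_zero] at this
    exact this
  have hu : IsUnit ((γ 1 1 : ℤ) : ZMod M) := IsUnit.of_mul_eq_one _ (by rw [mul_comm]; exact had)
  have hne : χ ((γ 1 1 : ℤ) : ZMod M) ≠ 0 := (hu.map χ).ne_zero
  rw [ModularForm.SL_slash_apply, Pi.smul_apply, smul_eq_mul, MulChar.inv_apply_eq_inv']
  change eisensteinOneCont χ (γ • z) 0 * denom γ z ^ (-(1 : ℤ)) =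
    (χ ((γ 1 1 : ℤ) : ZMod M))⁻¹ * eisensteinOneCont χ z 0
  have hD : denom γ z ≠ 0 := denom_ne_zero γ z
  rw [_root_.zpow_neg_one]
  field_simp
  linear_combination h

/-- **`G̃(·,0)` slashed by an arbitrary `A ∈ SL₂(ℤ)`** is the weighted sum of the congruence
Eisenstein series at `s = 0`: `(G̃ ∣₁ A)(z) = ∑_{v₀ mod M} W_A(v₀) congrCont(z, 0; v₀)`.
[cite: Hecke1927, §2] -/
theorem heckeOne_slash_apply (hodd : χ.Odd) (A : SL(2, ℤ)) (z : ℍ) :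
    (heckeOne χ ∣[(1 : ℤ)] A) z = ∑ p : Fin M × Fin M,
      cuspWeight χ A ![((p.1 : ℕ) : ℤ), ((p.2 : ℕ) : ℤ)] *
        congrCont M ![((p.1 : ℕ) : ℤ), ((p.2 : ℕ) : ℤ)] z 0 := by
  have hM : 0 < M := Nat.pos_of_ne_zero (NeZero.ne M)
  have hχ := ne_one_of_odd χ hodd
  have h := eq_sum_congrCont_of_eqOn χ hM A z (G := eisensteinOneCont χ (A • z))
    (differentiableOn_eisensteinOneCont χ hχ (A • z))
    (fun s hs ↦ eisensteinOneCont_eq_eisensteinOneAll χ hodd hs (A • z)) (s := 0) (by norm_num)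
  rw [ModularForm.SL_slash_apply]
  change eisensteinOneCont χ (A • z) 0 * denom A z ^ (-(1 : ℤ)) = _
  rw [h, _root_.zpow_neg_one, mul_comm (denom A z), mul_assoc, mul_inv_cancel₀ (denom_ne_zero A z), mul_one]

/-! ### The constants at `s = 0` -/

omit [NeZero M] in
/-- **The constant of `congrCont(·, 0; v₀)` at `i∞`**:
`M⁻¹ (𝟙[M ∣ c₀] 2 ζ_odd(d₀/M, 1) - 2πi ζ_odd(c₀/M, 0))`. [cite: Hecke1927, §2] -/
def congrConst (M : ℕ) (v₀ : Fin 2 → ℤ) : ℂ :=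
  (M : ℂ)⁻¹ * ((if (M : ℤ) ∣ v₀ 0 then
      2 * hurwitzZetaOdd (((v₀ 1 : ℝ) / (M : ℝ) : ℝ) : UnitAddCircle) 1 else 0) +
    2 * (-Complex.I * π) * hurwitzZetaOdd (((v₀ 0 : ℝ) / (M : ℝ) : ℝ) : UnitAddCircle) 0)

/-- `congrCont(z, 0; v₀) = congrConst v₀ + M⁻¹ ∑_u Σ_col(u)(z, 0)`. [cite: Hecke1927, §2] -/
theorem congrCont_zero_eq (v₀ : Fin 2 → ℤ) (z : ℍ) :
    congrCont M v₀ z 0 = congrConst M v₀ + (M : ℂ)⁻¹ * ∑' u : ℤ, congrColumn M v₀ z 0 u := by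
  have hM0 : (M : ℂ) ≠ 0 := by exact_mod_cast NeZero.ne M
  rw [congrCont, congrConst, constIntegral_zero]
  simp only [mul_zero, add_zero, sub_zero, cpow_zero, one_mul, mul_one, cpow_neg_one]
  ring

/-- **The column series tends to `0` at `i∞`** (it is `O(y⁻²)`). [cite: Hecke1927, §2] -/
theorem tendsto_tsum_congrColumn_zero_atImInfty (v₀ : Fin 2 → ℤ) :
    Tendsto (fun z : ℍ ↦ ∑' u : ℤ, congrColumn M v₀ z 0 u) atImInfty (𝓝 0) := by
  have hM : 0 < M := Nat.pos_of_ne_zero (NeZero.ne M)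
  have hM' : (0 : ℝ) < M := by exact_mod_cast hM
  -- the constant in front
  set K : ℝ := 160 * (1 + ‖(0 : ℂ)‖) ^ 2 * Real.exp (2 * π * |(0 : ℂ).im|) *
    (∫ v : ℝ, (1 + v ^ 2) ^ (-(3 + 2 * (0 : ℂ).re) / 2)) * (1 / 3) with hK
  have hK0 : 0 ≤ K := by
    have : 0 ≤ ∫ v : ℝ, (1 + v ^ 2) ^ (-(3 + 2 * (0 : ℂ).re) / 2) :=
      MeasureTheory.integral_nonneg fun v ↦ Real.rpow_nonneg (by positivity) _
    positivity
  set S : ℝ := ∑' u : ℤ, (if v₀ 0 + M * u = 0 then (0 : ℝ) else |((v₀ 0 + M * u : ℤ) : ℝ)| ^ (-(2 : ℝ)))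
    with hS
  have hSs := summable_abs_class_rpow_neg hM v₀ (p := 2) (by norm_num)
  have hS0 : 0 ≤ S := tsum_nonneg fun u ↦ by split_ifs <;> positivity
  -- the bound `‖∑_u Σ_col(u)(z,0)‖ ≤ K S (M/y)²`
  have hbound : ∀ z : ℍ, ‖∑' u : ℤ, congrColumn M v₀ z 0 u‖ ≤ K * S * ((M : ℝ) / z.im) ^ 2 := by
    intro z
    have hy : 0 < z.im := z.im_pos
    have hterm : ∀ u : ℤ, ‖congrColumn M v₀ z 0 u‖ ≤ K * ((M : ℝ) / z.im) ^ 2 *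
        (if v₀ 0 + M * u = 0 then (0 : ℝ) else |((v₀ 0 + M * u : ℤ) : ℝ)| ^ (-(2 : ℝ))) := by
      intro u
      have h := norm_congrColumn_le hM v₀ z (s := 0) (by norm_num) u
      refine h.trans (le_of_eq ?_)
      rw [← hK]
      split_ifs with h0
      · simp
      · have hc : 0 < |((v₀ 0 + M * u : ℤ) : ℝ)| := abs_pos.mpr (by exact_mod_cast h0)
        simp only [Complex.zero_re, mul_zero, sub_zero]
        rw [Real.rpow_neg (by positivity), Real.rpow_neg hc.le, Real.rpow_two, Real.rpow_two]
        field_simp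
    have hsum' : Summable fun u : ℤ ↦ K * ((M : ℝ) / z.im) ^ 2 *
        (if v₀ 0 + M * u = 0 then (0 : ℝ) else |((v₀ 0 + M * u : ℤ) : ℝ)| ^ (-(2 : ℝ))) :=
      hSs.mul_left _
    calc ‖∑' u : ℤ, congrColumn M v₀ z 0 u‖
        ≤ ∑' u : ℤ, K * ((M : ℝ) / z.im) ^ 2 *
          (if v₀ 0 + M * u = 0 then (0 : ℝ) else |((v₀ 0 + M * u : ℤ) : ℝ)| ^ (-(2 : ℝ))) :=
          tsum_of_norm_bounded hsum'.hasSum hterm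
      _ = K * S * ((M : ℝ) / z.im) ^ 2 := by rw [tsum_mul_left, hS]; ring
  -- `(M/y)² → 0`
  have him : Tendsto UpperHalfPlane.im atImInfty atTop := Filter.tendsto_comap
  have h0 : Tendsto (fun z : ℍ ↦ K * S * ((M : ℝ) / z.im) ^ 2) atImInfty (𝓝 0) := by
    have h1 : Tendsto (fun y : ℝ ↦ ((M : ℝ) / y) ^ 2) atTop (𝓝 0) := by
      simpa using ((Filter.Tendsto.div_atTop (tendsto_const_nhds (x := (M : ℝ))) tendsto_id).pow 2)
    simpa using (h1.comp him).const_mul (K * S)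
  rw [tendsto_zero_iff_norm_tendsto_zero]
  exact squeeze_zero (fun z ↦ norm_nonneg _) hbound h0

/-- **`congrCont(z, 0; v₀) → congrConst v₀`** as `Im z → ∞`. [cite: Hecke1927, §2] -/
theorem tendsto_congrCont_zero_atImInfty (v₀ : Fin 2 → ℤ) :
    Tendsto (fun z : ℍ ↦ congrCont M v₀ z 0) atImInfty (𝓝 (congrConst M v₀)) := by
  have h := ((tendsto_tsum_congrColumn_zero_atImInfty (M := M) v₀).const_mul ((M : ℂ)⁻¹)).const_add
    (congrConst M v₀)
  rw [mul_zero, add_zero] at h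
  refine h.congr fun z ↦ ?_
  rw [congrCont_zero_eq]

/-- **The constant term of `G̃(·,0) ∣₁ A` at `i∞`**, `∑_{v₀} W_A(v₀) congrConst(v₀)`.
[cite: Hecke1927, §2] -/
def heckeOneCusp (A : SL(2, ℤ)) : ℂ :=
  ∑ p : Fin M × Fin M, cuspWeight χ A ![((p.1 : ℕ) : ℤ), ((p.2 : ℕ) : ℤ)] *
    congrConst M ![((p.1 : ℕ) : ℤ), ((p.2 : ℕ) : ℤ)]

/-- **`G̃(·,0) ∣₁ A → heckeOneCusp A` at `i∞`** for every `A ∈ SL₂(ℤ)`. [cite: Hecke1927, §2] -/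
theorem tendsto_heckeOne_slash_atImInfty (hodd : χ.Odd) (A : SL(2, ℤ)) :
    Tendsto (heckeOne χ ∣[(1 : ℤ)] A) atImInfty (𝓝 (heckeOneCusp χ A)) := by
  have h : (heckeOne χ ∣[(1 : ℤ)] A) = fun z ↦ ∑ p : Fin M × Fin M,
      cuspWeight χ A ![((p.1 : ℕ) : ℤ), ((p.2 : ℕ) : ℤ)] *
        congrCont M ![((p.1 : ℕ) : ℤ), ((p.2 : ℕ) : ℤ)] z 0 :=
    funext fun z ↦ heckeOne_slash_apply χ hodd A z
  rw [h]
  exact tendsto_finsetSum _ fun p _ ↦ (tendsto_congrCont_zero_atImInfty _).const_mul _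

/-- `G̃(·,0) ∣₁ A` is bounded at `i∞`. [folklore] -/
theorem isBoundedAtImInfty_heckeOne_slash (hodd : χ.Odd) (A : SL(2, ℤ)) :
    IsBoundedAtImInfty (heckeOne χ ∣[(1 : ℤ)] A) :=
  (tendsto_heckeOne_slash_atImInfty χ hodd A).isBigO_one ℝ

/-! ### Holomorphy from the `q`-expansion -/

/-- The `q`-expansion coefficients of `G̃(·,0)`: `a₀ = 2L(χ,1)`,
`aₙ = -(4πiτ(χ)/M) ∑_{d∣n} χ̄(d)` (`n ≥ 1`). [cite: Miyake2006, Thm. 7.2.13] -/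
def heckeOneCoeff (n : ℕ) : ℂ :=
  if n = 0 then 2 * χ.LFunction 1 else
    -(4 * π * Complex.I * gaussSum χ (ZMod.stdAddChar (N := M)) / M) * ∑ d ∈ n.divisors, χ⁻¹ (d : ZMod M)

/-- The coefficients grow at most linearly. [folklore] -/
theorem norm_heckeOneCoeff_le (n : ℕ) :
    ‖heckeOneCoeff χ n‖ ≤ (‖2 * χ.LFunction 1‖ +
      ‖4 * π * Complex.I * gaussSum χ (ZMod.stdAddChar (N := M)) / M‖) * ((n : ℝ) + 1) ^ 1 := by
  rw [pow_one, heckeOneCoeff]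
  have hA : 0 ≤ ‖2 * χ.LFunction 1‖ := norm_nonneg _
  have hB : 0 ≤ ‖4 * π * Complex.I * gaussSum χ (ZMod.stdAddChar (N := M)) / M‖ := norm_nonneg _
  split_ifs with hn
  · subst hn
    simp only [Nat.cast_zero, zero_add, mul_one]
    linarith
  · rw [norm_mul, norm_neg]
    have hσ : ‖∑ d ∈ n.divisors, χ⁻¹ (d : ZMod M)‖ ≤ (n : ℝ) + 1 := by
      refine (norm_sum_le _ _).trans ?_
      calc ∑ d ∈ n.divisors, ‖χ⁻¹ (d : ZMod M)‖ ≤ ∑ d ∈ n.divisors, (1 : ℝ) :=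
            Finset.sum_le_sum fun d _ ↦ DirichletCharacter.norm_le_one _ _
        _ = n.divisors.card := by simp
        _ ≤ n := by exact_mod_cast Nat.card_divisors_le_self n
        _ ≤ (n : ℝ) + 1 := by linarith
    calc ‖4 * π * Complex.I * gaussSum χ (ZMod.stdAddChar (N := M)) / M‖ * ‖∑ d ∈ n.divisors, χ⁻¹ (d : ZMod M)‖
        ≤ ‖4 * π * Complex.I * gaussSum χ (ZMod.stdAddChar (N := M)) / M‖ * ((n : ℝ) + 1) :=
          mul_le_mul_of_nonneg_left hσ hB
      _ ≤ _ := by nlinarith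

/-- The `q`-series `∑ aₙ qⁿ` of `G̃(·,0)` converges absolutely on `ℍ`. [folklore] -/
theorem summable_heckeOneCoeff_mul_pow (z : ℍ) :
    Summable fun n : ℕ ↦ heckeOneCoeff χ n * cexp (2 * π * Complex.I * z) ^ n := by
  set q : ℂ := cexp (2 * π * Complex.I * z) with hq_def
  have hq : ‖q‖ < 1 := UpperHalfPlane.norm_exp_two_pi_I_lt_one z
  set B : ℝ := ‖2 * χ.LFunction 1‖ + ‖4 * π * Complex.I * gaussSum χ (ZMod.stdAddChar (N := M)) / M‖
    with hB
  have h1 : Summable fun n : ℕ ↦ ((n : ℝ) ^ 1 * ‖q‖ ^ n) :=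
    summable_pow_mul_geometric_of_norm_lt_one 1 (by rwa [norm_norm])
  have h2 : Summable fun n : ℕ ↦ ‖q‖ ^ n := summable_geometric_of_lt_one (norm_nonneg _) hq
  have hmaj : Summable fun n : ℕ ↦ B * ((n : ℝ) + 1) * ‖q‖ ^ n := by
    refine ((h1.add h2).mul_left B).congr fun n ↦ ?_
    rw [pow_one]; ring
  refine Summable.of_norm_bounded hmaj fun n ↦ ?_
  rw [norm_mul, norm_pow]
  have h := norm_heckeOneCoeff_le χ n
  rw [pow_one, ← hB] at h
  have hqn : 0 ≤ ‖q‖ ^ n := pow_nonneg (norm_nonneg _) n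
  calc ‖heckeOneCoeff χ n‖ * ‖q‖ ^ n ≤ (B * ((n : ℝ) + 1)) * ‖q‖ ^ n :=
        mul_le_mul_of_nonneg_right h hqn
    _ = _ := by ring

/-- **`G̃(z, 0) = ∑ₙ aₙ qⁿ`** (Hecke's `q`-expansion, repackaged). [cite: Miyake2006, Thm. 7.2.13] -/
theorem heckeOne_eq_qSeries (hprim : χ.IsPrimitive) (hodd : χ.Odd) (z : ℍ) :
    heckeOne χ z = ∑' n : ℕ, heckeOneCoeff χ n * cexp (2 * π * Complex.I * z) ^ n := by
  have hs := summable_heckeOneCoeff_mul_pow χ z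
  rw [heckeOne, eisensteinOneCont_zero_qExpansion χ hprim hodd z, hs.tsum_eq_zero_add]
  simp only [heckeOneCoeff, if_true, pow_zero, mul_one, Nat.add_eq_zero_iff, one_ne_zero,
    and_false, if_false]
  rw [sub_eq_add_neg, ← tsum_mul_left, ← tsum_neg]
  congr 1
  refine tsum_congr fun m ↦ ?_
  ring

/-- **`G̃(·, 0)` is holomorphic on `ℍ`.** [cite: Hecke1927, §2] -/
theorem mdifferentiable_heckeOne (hprim : χ.IsPrimitive) (hodd : χ.Odd) :
    MDifferentiable 𝓘(ℂ) 𝓘(ℂ) (heckeOne χ) :=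
  mdifferentiable_of_eq_qSeries (norm_heckeOneCoeff_le χ) (heckeOne_eq_qSeries χ hprim hodd)

/-! ### The modular form -/

/-- `G̃(·,0)` is invariant under `Γ₁(M)`. [folklore] -/
theorem heckeOne_slash_of_mem_gamma1 (hodd : χ.Odd) {γ : SL(2, ℤ)} (hγ : γ ∈ Gamma1 M) :
    heckeOne χ ∣[(1 : ℤ)] γ = heckeOne χ := by
  rw [Gamma1_mem] at hγ
  rw [heckeOne_slash_of_mem_gamma0 χ hodd (Gamma0_mem.2 hγ.2.2), hγ.2.1, map_one, one_smul]

/-- **Hecke's weight-one Eisenstein series `G̃_χ(·, 0)` as a modular form of weight `1` on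
`Γ₁(M)`** (`χ` odd primitive). [cite: Hecke1927, §2] [cite: Miyake2006, Thm. 7.2.13] -/
def heckeOneMF (hprim : χ.IsPrimitive) (hodd : χ.Odd) : ModularForm (Gamma1 M) 1 where
  toFun := heckeOne χ
  slash_action_eq' A hA := by
    obtain ⟨A, (hA : A ∈ Gamma1 M), rfl⟩ := hA
    exact heckeOne_slash_of_mem_gamma1 χ hodd hA
  holo' := mdifferentiable_heckeOne χ hprim hodd
  bdd_at_cusps' {c} hc := by
    rw [Subgroup.IsArithmetic.isCusp_iff_isCusp_SL2Z] at hc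
    rw [OnePoint.isBoundedAt_iff_forall_SL2Z hc]
    intro γ _
    exact isBoundedAtImInfty_heckeOne_slash χ hodd γ

/-- The function of `heckeOneMF`. [folklore] -/
@[simp] theorem coe_heckeOneMF (hprim : χ.IsPrimitive) (hodd : χ.Odd) :
    (⇑(heckeOneMF χ hprim hodd) : ℍ → ℂ) = heckeOne χ := rfl

/-- **The `q`-expansion of the modular form `G̃_χ(·,0)`**: `a₀ = 2L(χ,1)`,
`aₙ = -(4πiτ(χ)/M) σ^{χ̄}(n)`. [cite: Miyake2006, Thm. 7.2.13] -/
theorem qExpansion_coeff_heckeOneMF (hprim : χ.IsPrimitive) (hodd : χ.Odd) (n : ℕ) :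
    (qExpansion 1 ⇑(heckeOneMF χ hprim hodd)).coeff n = heckeOneCoeff χ n := by
  suffices h : ∀ τ : ℍ, HasSum (fun m ↦ heckeOneCoeff χ m • Function.Periodic.qParam (1 : ℝ) τ ^ m)
      (heckeOneMF χ hprim hodd τ) from
    (ModularFormClass.qExpansion_coeff_unique one_pos (by simp) h n).symm
  intro τ
  change HasSum (fun m ↦ heckeOneCoeff χ m * Function.Periodic.qParam (1 : ℝ) τ ^ m) (heckeOne χ τ)
  have h := (summable_heckeOneCoeff_mul_pow χ τ).hasSum
  rw [← heckeOne_eq_qSeries χ hprim hodd τ] at h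
  simp only [Function.Periodic.qParam, Complex.ofReal_one, div_one]
  exact h

/-- Nebentypus law for the modular form. [cite: Miyake2006, Thm. 7.2.13] -/
theorem heckeOneMF_slash_of_mem_gamma0 (hprim : χ.IsPrimitive) (hodd : χ.Odd) {γ : SL(2, ℤ)}
    (hγ : γ ∈ Gamma0 M) :
    (⇑(heckeOneMF χ hprim hodd) : ℍ → ℂ) ∣[(1 : ℤ)] γ =
      χ⁻¹ ((γ 1 1 : ℤ) : ZMod M) • (⇑(heckeOneMF χ hprim hodd) : ℍ → ℂ) :=
  heckeOne_slash_of_mem_gamma0 χ hodd hγ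

/-- Limits of the modular form at all cusps. [cite: Hecke1927, §2] -/
theorem tendsto_heckeOneMF_slash_atImInfty (hprim : χ.IsPrimitive) (hodd : χ.Odd) (A : SL(2, ℤ)) :
    Tendsto ((⇑(heckeOneMF χ hprim hodd) : ℍ → ℂ) ∣[(1 : ℤ)] A) atImInfty (𝓝 (heckeOneCusp χ A)) :=
  tendsto_heckeOne_slash_atImInfty χ hodd A

end Hecke

end Literature.NumberTheory.EllipticCurves.ModularForms
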